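import Summits.ABC.IUTFork.Cor312SoundInput
import Summits.ABC.IUTFork.Cor312TeamAGapWitnessB
import HarnessLib

/-!
# [IUTchIII] Cor. 3.12 — GapA (`SoundAtInput`) is JOINTLY SATISFIABLE with the premises, non-trivially

Record-only file (D-0012) of the abc-iut cell (WAVE-5 prover seat abc-iut-w5-d236; evidence for
`HOME/plan/ADJUDICATION-SPEC.md` §4 (iii) NON-VACUITY of outcome (G), whose gap statement of record is
Team A's `Cor312Vol.SoundAtInput` of `Cor312SoundInput.lean`); TAKES NO SIDE.

What is kernel-checked here, at the INTERFACE level (same toy carriers as Team A's gap witness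
`Cor312TeamAGapWitness{,B}` — `l⋇ = 2`, one place, nontrivial `ℚ`-packets, hull frame `{{0}, univ}`,
the typed Theorem 3.11 (i) ∧ (ii) ∧ (iii) holding in full):

* §1 `soundAtInput_iff_statement_of_subsingleton` — at ANY setting whose Frobenioid `†𝒞^⊩_lgp` has a single
  object (up to the kernel's `Subsingleton`), GapA IS the printed Statement: the universal quantifier over
  inputs carries no further content there. Consequence `not_soundAtInput_gapSetting`: GapA fails (for every
  gluing) at Team A's gap setting — the (G3) direction, already implicit in
  `GapWitness.thm311_bridgeHyps_not_imp_statement` + `statement_of_soundAtInput`.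
* §2–§4 `soundSetting` — the MIRROR of the gap setting (Θ-pilot Kummer image = the whole packet, log-volume
  `−1`; `q`-pilot image = the hull-set `{0}`, log-volume `−2`): typed Thm. 3.11 holds (it is Team A's
  `gapFull`, untouched), ALL bridge hypotheses hold, `|log(q)| > 0`, and GapA HOLDS with the STRICT
  inequality `−|log(q)| = −2 < −1 = −|log(Θ)|` (`soundSetting_soundAtInput`, `soundSetting_strict`).
* (companion `Cor312SoundInputTwoObjects`: a two-object setting where the typed Corollary HOLDS and GapA
  FAILS — GapA is strictly stronger than the typed Statement over the interfaces.)
* §5 `premises_and_soundAtInput_satisfiable` — the ∃-form the referee protocol asks for: typed Thm. 3.11 ∧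
  `BridgeHyps` ∧ `AbsLogQPos` ∧ GapA are jointly satisfiable at a setting where the Statement is NOT
  attained as an equality (contrast Team R's `negLogTheta_eq` under the identified-copies reading): GapA
  does not, at the interface level, force the Scholze–Stix collapse `−|log(Θ)| = −|log(q)|`. Together with
  §1: `soundAtInput_independent` — GapA is INDEPENDENT of the frozen premises (holds here, fails at the gap
  setting), i.e. it is a genuine additional input, consistent with everything the (G) sentence grants.

HONEST SCOPE: interface-level only, exactly as Team A's witness; nothing here says anything about the
assembled real setting, and nothing asserts or denies [IUTchIII] Cor. 3.12 or any reading of Step (xi).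
[claim: Mochizuki2012, status: disputed] [cite: ScholzeStix2018, §2.2 pp. 9–10]
-/

noncomputable section

namespace Summit.ABC

namespace IUTFork

namespace Cor312Vol

open Thm311 Cor312 Cor312.Checks Literature.IUT.LogThetaLattice

/-! ## 1. GapA at a one-object Frobenioid is the Statement -/

/-- At a setting whose `†𝒞^⊩_lgp` has (kernel-)exactly one object, Team A's GapA `SoundAtInput P G` is
EQUIVALENT to the printed Statement, for every gluing `G`: the only input is the Θ-pilot object, whose
gluing image is the `q`-pilot object by (xi-a). [folklore] -/
theorem soundAtInput_iff_statement_of_subsingleton {T : ThetaIndex} {S : Situation T}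
    (P : Cor312.Setting S) [Subsingleton (P.Ob P.sig.Clgp)] (G : LinkGluing P) :
    SoundAtInput P G ↔ P.Statement := by
  refine ⟨statement_of_soundAtInput P G, fun h o => ?_⟩
  obtain rfl : o = P.thetaPilot := Subsingleton.elim _ _
  rw [negLogThetaAt_thetaPilot, G.link_thetaPilot, negLogQAt_qPilot]
  exact h

/-- GapA FAILS at Team A's gap setting, for every gluing (the Statement fails there,
`GapWitness.gapSetting_not_statement`). [folklore] -/
theorem not_soundAtInput_gapSetting (G : LinkGluing GapWitness.gapSetting) :
    ¬ SoundAtInput GapWitness.gapSetting G :=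
  fun h => GapWitness.gapSetting_not_statement (statement_of_soundAtInput _ G h)

namespace SoundWitness

open GapWitness

/-! ## 2. The sound setting: the mirror image of the gap setting -/

/-- The SOUND setting over Team A's `gapSituation` (same lattice, one-point pilots, hull frame
`{{0}, univ}`, log-volume `−2` inside `{0}` and `−1` outside): the Θ-pilot Kummer image is the WHOLE packet
at every `m`, the `q`-pilot image is the hull-set `{0}`. [folklore] -/
def soundSetting : Cor312.Setting gapSituation where
  n := 0
  HT := ℤ × ℤ
  LogLink := fun _ _ => Unit
  IsFull := fun _ => True
  lattice :=
    { theater := fun n m => (n, m)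
      distinct := fun p q h => by simpa using h
      logLink := fun _ _ => ()
      logLink_full := fun _ _ => trivial }
  Frd := Unit
  IsoF := fun _ _ => Unit
  Ob := fun _ => Unit
  realify := id
  Strip := Unit
  IsoS := fun _ _ => Unit
  M := fun _ _ => Unit
  sig := toySig
  split := { Msplit := fun _ _ => ⊤, exists_gen := fun _ _ => ⟨⟨(), trivial⟩, top_unit_isGenerator _⟩ }
  ObΔ := Unit
  N := fun _ _ => Unit
  qData := { q := fun _ _ => (), q_gen := fun _ _ => unit_isGenerator _, objOf := fun _ => () }
  frame := fun j vQ => gapFrame _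
  hul_adm := fun _ _ _ _ => trivial
  thetaRegionOf := fun _ _ _ _ => Set.univ
  qRegionOf := fun _ _ _ => {0}
  qRegion_mem := fun _ _ => Set.mem_insert _ _
  qSupport_finite := fun _ => Set.toFinite _

/-- The value-group gluing of the sound setting (one object on each side; (xi-a) by `rfl`). [folklore] -/
def soundGluing : LinkGluing soundSetting := ⟨fun _ => (), rfl⟩

/-! ## 3. The two quantities: `−|log(Θ)| = −1`, `−|log(q)| = −2` -/

/-- The (Ind3)-enlarged Θ-pilot region is the whole packet. [folklore] -/
theorem sound_thetaRegion3 (j : toyIndex.Label) (vQ : toyIndex.VQ) :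
    soundSetting.thetaRegion3 j vQ = Set.univ := by
  show (⋃ _ : ℤ, (Set.univ : Set (toyShells.Packet j vQ))) = Set.univ
  exact Set.iUnion_const _

/-- The possible images of the Θ-pilot object are exactly the whole packet (every indeterminacy is a
`ℚ`-linear automorphism, hence onto). [folklore] -/
theorem sound_mem_possibleImages_iff (j : toyIndex.Label) (vQ : toyIndex.VQ)
    (U : Set (toyShells.Packet j vQ)) :
    U ∈ soundSetting.possibleImages j vQ ↔ U = Set.univ := by
  constructor
  · rintro ⟨Φ, -, rfl⟩
    rw [sound_thetaRegion3]
    exact Set.image_univ_of_surjective (Φ j vQ).surjective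
  · rintro rfl
    exact sound_thetaRegion3 j vQ ▸ soundSetting.thetaRegion3_mem_possibleImages j vQ

/-- The union of the possible images is the whole packet. [folklore] -/
theorem sound_sUnion_possibleImages (j : toyIndex.Label) (vQ : toyIndex.VQ) :
    ⋃₀ soundSetting.possibleImages j vQ = (Set.univ : Set (toyShells.Packet j vQ)) := by
  refine Set.eq_univ_of_univ_subset (Set.subset_sUnion_of_mem ?_)
  exact (sound_mem_possibleImages_iff j vQ _).2 rfl

/-- The packet hull `^{n,∘}𝒰_{j,v_ℚ}` of the sound setting is the whole packet. [folklore] -/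
theorem sound_thetaHull (j : toyIndex.Label) (vQ : toyIndex.VQ) :
    soundSetting.thetaHull j vQ = (Set.univ : Set (toyShells.Packet j vQ)) := by
  refine Set.eq_univ_of_univ_subset ?_
  exact ((sound_sUnion_possibleImages j vQ).symm.le).trans
    ((gapFrame (toyShells.Packet j vQ)).subset_hull (⋃₀ soundSetting.possibleImages j vQ))

/-- Every union of possible images admits its hull. [folklore] -/
theorem sound_hullDefined (j : toyIndex.Label) (vQ : toyIndex.VQ) :
    soundSetting.HullDefined j vQ := ⟨trivial, trivial⟩

/-- The local Θ-volume is `−1` in every packet. [folklore] -/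
theorem sound_thetaLocal (j : toyIndex.Label) (vQ : toyIndex.VQ) :
    soundSetting.thetaLocal j vQ = ((-1 : ℝ) : WithTop ℝ) := by
  unfold Cor312.Setting.thetaLocal
  rw [if_pos (sound_hullDefined j vQ)]
  show ((gapData.logvol j vQ (soundSetting.thetaHull j vQ) : ℝ) : WithTop ℝ) = _
  rw [sound_thetaHull, gapData_logvol_univ]

/-- The local `q`-volume is `−2` in every packet. [folklore] -/
theorem sound_qLocal (j : toyIndex.Label) (vQ : toyIndex.VQ) : soundSetting.qLocal j vQ = -2 :=
  gapData_logvol_of_subset subset_rfl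

/-- The sound setting is `ThetaFinite`. [folklore] -/
theorem sound_thetaFinite : soundSetting.ThetaFinite :=
  ⟨fun i vQ => by rw [sound_thetaLocal]; exact WithTop.coe_ne_top, fun _ => Set.toFinite _⟩

/-- `−|log(Θ)| = −1` in the sound setting. [folklore] -/
theorem sound_negLogTheta : soundSetting.negLogTheta = ((-1 : ℝ) : WithTop ℝ) := by
  unfold Cor312.Setting.negLogTheta
  rw [if_pos sound_thetaFinite]
  have h : ∀ i : Fin toyIndex.lstar,
      (∑ᶠ vQ : toyIndex.VQ, (soundSetting.thetaLocal (Cor312.Setting.labelSucc i) vQ).untopD 0) = -1 := by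
    intro i
    have h1 : (fun vQ : toyIndex.VQ =>
        (soundSetting.thetaLocal (Cor312.Setting.labelSucc i) vQ).untopD 0) = fun _ => (-1 : ℝ) := by
      funext vQ
      rw [sound_thetaLocal, WithTop.untopD_coe]
    rw [h1, finsum_unique]
  simp only [h]
  exact congrArg _ (processionNormalized_const (by decide) (-1))

/-- `−|log(q)| = −2` in the sound setting. [folklore] -/
theorem sound_negLogQ : soundSetting.negLogQ = -2 := by
  unfold Cor312.Setting.negLogQ
  have h : ∀ i : Fin toyIndex.lstar,
      (∑ᶠ vQ : toyIndex.VQ, soundSetting.qLocal (Cor312.Setting.labelSucc i) vQ) = -2 := by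
    intro i
    have h1 : (fun vQ : toyIndex.VQ => soundSetting.qLocal (Cor312.Setting.labelSucc i) vQ) =
        fun _ => (-2 : ℝ) := by
      funext vQ
      exact sound_qLocal _ vQ
    rw [h1, finsum_unique]
  simp only [h]
  exact processionNormalized_const (by decide) (-2)

/-! ## 4. Premises, the Statement (strictly), and GapA hold in the sound setting -/

/-- All bridge hypotheses of `Cor312StatementBridge` hold in the sound setting. [folklore] -/
theorem soundSetting_bridgeHyps : BridgeHyps soundSetting where
  mono := fun i vQ A B _ _ hAB => gapData_logvol_mono hAB
  image_adm := fun _ _ _ _ => trivial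
  image_fin := fun _ => Set.toFinite _
  hul_nonempty := fun j vQ H hH => by
    rcases hH with rfl | rfl
    · exact ⟨0, rfl⟩
    · exact ⟨0, Set.mem_univ 0⟩
  theta_nonempty := fun i vQ => by
    rw [sound_thetaRegion3]
    exact ⟨0, Set.mem_univ 0⟩
  finite := sound_thetaFinite

/-- "`|log(q)| > 0`" holds in the sound setting (`−|log(q)| = −2 < 0`). [folklore] -/
theorem soundSetting_absLogQPos : soundSetting.AbsLogQPos := by
  show soundSetting.negLogQ < 0
  rw [sound_negLogQ]; norm_num

/-- The typed Corollary 3.12 HOLDS in the sound setting (`−2 ≤ −1`). [folklore] -/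
theorem soundSetting_statement : soundSetting.Statement := by
  refine ⟨by rw [sound_negLogTheta]; exact WithTop.coe_ne_top, ?_⟩
  rw [sound_negLogQ, sound_negLogTheta, WithTop.coe_le_coe]
  norm_num

/-- … and STRICTLY: `−|log(q)| = −2 < −1 = −|log(Θ)|` — the two printed quantities do NOT coincide (contrast
Team R's `negLogTheta_eq` under the identified-copies reading). [folklore] -/
theorem soundSetting_strict :
    ((soundSetting.negLogQ : ℝ) : WithTop ℝ) < soundSetting.negLogTheta := by
  rw [sound_negLogQ, sound_negLogTheta, WithTop.coe_lt_coe]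
  norm_num

/-- **GapA HOLDS in the sound setting** (one input object; by §1 it is the Statement there). [folklore] -/
theorem soundSetting_soundAtInput : SoundAtInput soundSetting soundGluing :=
  haveI : Subsingleton (soundSetting.Ob soundSetting.sig.Clgp) := inferInstanceAs (Subsingleton Unit)
  (soundAtInput_iff_statement_of_subsingleton soundSetting soundGluing).2 soundSetting_statement

/-! ## 5. Joint satisfiability and independence, as ∃-statements -/

/-- **NON-VACUITY OF OUTCOME (G)** (`plan/ADJUDICATION-SPEC.md` §4 (iii)): there is an instantiation in
which the typed Theorem 3.11 (i) ∧ (ii) ∧ (iii) holds in full, every bridge hypothesis holds, `|log(q)| > 0`,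
Team A's GapA `SoundAtInput` holds — and the two printed quantities are DISTINCT (`−|log(q)| < −|log(Θ)|`).
So the premise set {typed Thm. 3.11, `BridgeHyps`, `AbsLogQPos`, GapA} of the (G) sentence is consistent
and does not force the identified-copies collapse. Interface-level; no side taken. [folklore] -/
theorem premises_and_soundAtInput_satisfiable :
    ∃ (T : ThetaIndex) (F : FullSituation T) (P : Cor312.Setting F.toLatticeSituation.toSituation)
      (G : LinkGluing P),
      F.Statement ∧ BridgeHyps P ∧ P.AbsLogQPos ∧ SoundAtInput P G ∧
        ((P.negLogQ : ℝ) : WithTop ℝ) < P.negLogTheta :=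
  ⟨toyIndex, gapFull, soundSetting, soundGluing, gapFull_statement, soundSetting_bridgeHyps,
    soundSetting_absLogQPos, soundSetting_soundAtInput, soundSetting_strict⟩

/-- **GapA IS INDEPENDENT OF THE FROZEN PREMISES** (interface level): over ONE typed Theorem 3.11 situation
(`GapWitness.gapFull`, (i) ∧ (ii) ∧ (iii) in full) there are TWO verbatim settings, both satisfying every
bridge hypothesis and `|log(q)| > 0`, one in which GapA holds (for some gluing) and one in which it fails
(for every gluing). [folklore] -/
theorem soundAtInput_independent :
    ∃ (T : ThetaIndex) (F : FullSituation T), F.Statement ∧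
      (∃ (P : Cor312.Setting F.toLatticeSituation.toSituation) (G : LinkGluing P),
          BridgeHyps P ∧ P.AbsLogQPos ∧ SoundAtInput P G) ∧
      (∃ (P : Cor312.Setting F.toLatticeSituation.toSituation),
          BridgeHyps P ∧ P.AbsLogQPos ∧ ∀ G : LinkGluing P, ¬ SoundAtInput P G) :=
  ⟨toyIndex, gapFull, gapFull_statement,
    ⟨soundSetting, soundGluing, soundSetting_bridgeHyps, soundSetting_absLogQPos,
      soundSetting_soundAtInput⟩,
    ⟨gapSetting, gapSetting_bridgeHyps, gapSetting_absLogQPos, not_soundAtInput_gapSetting⟩⟩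

end SoundWitness


end Cor312Vol

end IUTFork

end Summit.ABC

end
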